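import Summits.AtomisticToContinuum.FouriersLaw.Theorems.OddSectorIrreversibilityResponseDensityExactResponse

/-!
# Linear response of the pinned chain at equilibrium, from uniform mixing and kernel continuity

Helper file for item stmt-AtomisticToContinuum-9144 (`ResponseDensity`, route
`OddSectorIrreversibility`, sub-problem `FouriersLaw` of `AtomisticToContinuum`).

From the exact response identity (`…ResponseDensityResponseIdentity.lean`): IF the exponential
convergence (2.5) of the transition semigroups with baths at `T ± δ/2` holds with constants UNIFORM in
`|δ| < δ₀` (hypothesis `hUM`), and the forecasts `P_s^{(δ)} φ(x)` are continuous in `δ` at `δ = 0`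
(hypothesis `hCONT`), then for every family `μ_δ` of invariant probability measures and every
`φ ∈ C²` with `|φ| ≤ C e^{ϑH}`, the steady-state expectation is differentiable in `δ` at `0`:

  `δ⁻¹ (μ_δ(φ) - μ_0(φ)) → (γ/2T²) Z⁻¹ ∫₀^∞ ∫ P_s φ · e^{-H/T}(p_0² - p_{N-1}²) dx ds`  (`δ → 0`, `δ ≠ 0`),

`P_s` the EQUILIBRIUM kernels and `Z = ∫ e^{-H/T} dx` (`pinnedChain_linear_response_of_uniformMixing`).
The two hypotheses are explicit binders (no named facts): `hUM` is the `δ`-uniform form of CEHR (2.5)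
(Harris' theorem with Lyapunov/minorisation constants uniform for bath temperatures in a compact set);
`hCONT` is the continuity of the law of the SDE solution in the noise amplitudes. No definitions.
-/

noncomputable section

open MeasureTheory ProbabilityTheory Filter Topology Set
open scoped NNReal ENNReal ContDiff

namespace Summit.AtomisticToContinuum.FouriersLaw.Theorems

open Literature.MathematicalPhysics.KineticTheory.HeatConduction
open Literature.Probability.Process Literature.MathematicalPhysics.KineticTheory OscillatorChain

variable {N : ℕ}

section OddMomentBound

variable {ω₂ lam β γ : ℝ} (hω : 0 < ω₂) (hl : 0 ≤ lam) (hβ : 0 ≤ β) (hγ : 0 < γ)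
  (hN : 0 < N) {T δ : ℝ} (hT : 0 < T) (hTL : 0 < T + δ / 2) (hTR : 0 < T - δ / 2)
  {ϑ : ℝ} (hϑ : 0 < ϑ) (hϑ' : ϑ < 1 / max (T + δ / 2) (T - δ / 2))
  {φ : PhaseSpace N → ℝ} (hφ2 : ContDiff ℝ 2 φ) {C : ℝ}
  (hφ : ∀ y, |φ y| ≤ C * Real.exp (ϑ * (pinnedChain ω₂ lam β γ).hamiltonian N y))
include hω hl hβ hγ hN hT hTL hTR hϑ hϑ' hφ2 hφ

/-- **The odd-moment pairing decays exponentially, with constants controlled by the mixing constants.**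
If `|P_t f(z) - μ(f)| ≤ C_m e^{ϑH(z)} e^{-ct}` for continuous `|f| ≤ e^{ϑH}` (some probability measure
`μ`), then for `s > 0`
`|∫ P_s φ · e^{-H/T}(p_0² - p_{N-1}²) dx| ≤ max(C,1) C_m (∫ (1 + p_0² + p_{N-1}²) e^{(ϑ-1/T)H} dx) e^{-cs}`
(the odd Gibbs moment vanishes, so `μ(φ)` may be subtracted for free). -/
theorem abs_oddMoment_pairing_le_of_mixing (hδ0 : ∃ δ' : ℝ, δ' ≠ 0 ∧ 0 < T + δ' / 2 ∧ 0 < T - δ' / 2 ∧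
      ϑ < 1 / max (T + δ' / 2) (T - δ' / 2))
    (μ : Measure (PhaseSpace N)) {Cm c : ℝ} (hCm : 0 ≤ Cm)
    (hmix : ∀ (z : PhaseSpace N) (t : ℝ≥0) (f : PhaseSpace N → ℝ), Continuous f →
      (∀ y, |f y| ≤ Real.exp (ϑ * (pinnedChain ω₂ lam β γ).hamiltonian N y)) →
      |(∫ y, f y ∂((pinnedChain ω₂ lam β γ).transitionKernel N (T + δ / 2) (T - δ / 2) t z)) -
          ∫ y, f y ∂μ| ≤
        Cm * Real.exp (ϑ * (pinnedChain ω₂ lam β γ).hamiltonian N z) * Real.exp (-c * t))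
    {s : ℝ} (hs : 0 < s) :
    |∫ x, (∫ y, φ y ∂((pinnedChain ω₂ lam β γ).transitionKernel N (T + δ / 2) (T - δ / 2)
          s.toNNReal x)) *
        (Real.exp (-1 / T * (pinnedChain ω₂ lam β γ).hamiltonian N x) *
          (x.2 ⟨0, hN⟩ ^ 2 - x.2 ⟨N - 1, by omega⟩ ^ 2))| ≤
      max C 1 * Cm * (∫ x : PhaseSpace N, (1 + x.2 ⟨0, hN⟩ ^ 2 + x.2 ⟨N - 1, by omega⟩ ^ 2) *
        Real.exp ((-1 / T + ϑ) * (pinnedChain ω₂ lam β γ).hamiltonian N x)) * Real.exp (-c * s) := by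
  have hθϑ := neg_inv_add_lt_zero hT hϑ' (δ := δ)
  have hHc : Continuous ((pinnedChain ω₂ lam β γ).hamiltonian N) :=
    (pinnedChain_contDiff_hamiltonian ω₂ lam β γ N (n := 0)).continuous
  have hφc : Continuous φ := hφ2.continuous
  set M : ℝ := max C 1 with hM
  have hM0 : 0 < M := lt_max_of_lt_right one_pos
  -- (2.5)-type bound for `φ` (rescaled by `M`)
  have hmixφ : ∀ (t : ℝ≥0) (z : PhaseSpace N),
      |(∫ y, φ y ∂((pinnedChain ω₂ lam β γ).transitionKernel N (T + δ / 2) (T - δ / 2) t z)) -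
          ∫ y, φ y ∂μ| ≤
        M * Cm * Real.exp (ϑ * (pinnedChain ω₂ lam β γ).hamiltonian N z) * Real.exp (-c * t) := by
    intro t z
    have hf : ∀ y, |φ y / M| ≤ Real.exp (ϑ * (pinnedChain ω₂ lam β γ).hamiltonian N y) := fun y => by
      rw [abs_div, abs_of_pos hM0, div_le_iff₀ hM0]
      calc |φ y| ≤ C * Real.exp (ϑ * (pinnedChain ω₂ lam β γ).hamiltonian N y) := hφ y
        _ ≤ M * Real.exp (ϑ * (pinnedChain ω₂ lam β γ).hamiltonian N y) :=
          mul_le_mul_of_nonneg_right (le_max_left _ _) (Real.exp_pos _).le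
        _ = Real.exp (ϑ * (pinnedChain ω₂ lam β γ).hamiltonian N y) * M := mul_comm _ _
    have h := hmix z t (fun y => φ y / M) (hφc.div_const M) hf
    rw [integral_div, integral_div, ← sub_div, abs_div, abs_of_pos hM0, div_le_iff₀ hM0] at h
    calc _ ≤ Cm * Real.exp (ϑ * (pinnedChain ω₂ lam β γ).hamiltonian N z) * Real.exp (-c * t) * M := h
      _ = _ := by ring
  -- the odd Gibbs moment vanishes (from the identity at some `δ' ≠ 0`)
  obtain ⟨δ', hδ'0, hTL', hTR', hϑ''⟩ := hδ0
  have hG₀ := integral_gibbsWeight_oddMoment_eq_zero hω hl hβ hγ hN hT hTL' hTR' hϑ hϑ'' (N := N) hδ'0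
  have hIw := integrable_momentSq_mul_exp_mul_hamiltonian hω hl hβ γ hN hθϑ
  have hIs := integrable_forecast_mul_oddMoment hω hl hβ hγ hN hT hTL hTR hϑ hϑ' hφ2 hφ s.toNNReal
  have hw : Integrable (fun x : PhaseSpace N => Real.exp (-1 / T * (pinnedChain ω₂ lam β γ).hamiltonian N x) *
      (x.2 ⟨0, hN⟩ ^ 2 - x.2 ⟨N - 1, by omega⟩ ^ 2)) := by
    have h1 := integrable_momentSq_mul_exp_mul_hamiltonian hω hl hβ γ hN (c := -1 / T)
      (by rw [neg_div]; exact neg_neg_of_pos (one_div_pos.2 hT))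
    refine h1.mono' ((Real.continuous_exp.comp (continuous_const.mul hHc)).mul
      ((((continuous_apply _).comp continuous_snd).pow 2).sub
        (((continuous_apply _).comp continuous_snd).pow 2))).aestronglyMeasurable
      (Eventually.of_forall fun x => ?_)
    rw [Real.norm_eq_abs, abs_mul, abs_of_pos (Real.exp_pos _), mul_comm]
    refine mul_le_mul_of_nonneg_right ?_ (Real.exp_pos _).le
    have h1 : 0 ≤ x.2 ⟨0, hN⟩ ^ 2 := sq_nonneg _
    have h2 : 0 ≤ x.2 ⟨N - 1, by omega⟩ ^ 2 := sq_nonneg _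
    rw [abs_le]; constructor <;> linarith
  have hsub : (∫ x, (∫ y, φ y ∂((pinnedChain ω₂ lam β γ).transitionKernel N (T + δ / 2) (T - δ / 2)
        s.toNNReal x)) *
      (Real.exp (-1 / T * (pinnedChain ω₂ lam β γ).hamiltonian N x) *
        (x.2 ⟨0, hN⟩ ^ 2 - x.2 ⟨N - 1, by omega⟩ ^ 2))) =
      ∫ x, ((∫ y, φ y ∂((pinnedChain ω₂ lam β γ).transitionKernel N (T + δ / 2) (T - δ / 2)
          s.toNNReal x)) - ∫ y, φ y ∂μ) *
        (Real.exp (-1 / T * (pinnedChain ω₂ lam β γ).hamiltonian N x) *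
          (x.2 ⟨0, hN⟩ ^ 2 - x.2 ⟨N - 1, by omega⟩ ^ 2)) := by
    simp_rw [sub_mul]
    rw [integral_sub hIs (hw.const_mul _), integral_const_mul, hG₀, mul_zero, sub_zero]
  rw [hsub]
  have hbd : ∀ x : PhaseSpace N,
      ‖((∫ y, φ y ∂((pinnedChain ω₂ lam β γ).transitionKernel N (T + δ / 2) (T - δ / 2)
          s.toNNReal x)) - ∫ y, φ y ∂μ) *
        (Real.exp (-1 / T * (pinnedChain ω₂ lam β γ).hamiltonian N x) *
          (x.2 ⟨0, hN⟩ ^ 2 - x.2 ⟨N - 1, by omega⟩ ^ 2))‖ ≤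
      M * Cm * Real.exp (-c * s) *
        ((1 + x.2 ⟨0, hN⟩ ^ 2 + x.2 ⟨N - 1, by omega⟩ ^ 2) *
          Real.exp ((-1 / T + ϑ) * (pinnedChain ω₂ lam β γ).hamiltonian N x)) := by
    intro x
    have hm := hmixφ s.toNNReal x
    rw [Real.coe_toNNReal _ hs.le] at hm
    have hp : |x.2 ⟨0, hN⟩ ^ 2 - x.2 ⟨N - 1, by omega⟩ ^ 2| ≤
        1 + x.2 ⟨0, hN⟩ ^ 2 + x.2 ⟨N - 1, by omega⟩ ^ 2 := by
      have h1 : 0 ≤ x.2 ⟨0, hN⟩ ^ 2 := sq_nonneg _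
      have h2 : 0 ≤ x.2 ⟨N - 1, by omega⟩ ^ 2 := sq_nonneg _
      rw [abs_le]; constructor <;> linarith
    rw [norm_mul, norm_mul, Real.norm_eq_abs, Real.norm_eq_abs, Real.norm_eq_abs,
      abs_of_pos (Real.exp_pos _),
      show (-1 / T + ϑ) * (pinnedChain ω₂ lam β γ).hamiltonian N x =
        -1 / T * (pinnedChain ω₂ lam β γ).hamiltonian N x + ϑ * (pinnedChain ω₂ lam β γ).hamiltonian N x
        by ring, Real.exp_add]
    have hE1 := (Real.exp_pos (-1 / T * (pinnedChain ω₂ lam β γ).hamiltonian N x)).le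
    calc _ ≤ (M * Cm * Real.exp (ϑ * (pinnedChain ω₂ lam β γ).hamiltonian N x) * Real.exp (-c * s)) *
          (Real.exp (-1 / T * (pinnedChain ω₂ lam β γ).hamiltonian N x) *
            (1 + x.2 ⟨0, hN⟩ ^ 2 + x.2 ⟨N - 1, by omega⟩ ^ 2)) :=
          mul_le_mul hm (mul_le_mul_of_nonneg_left hp hE1) (by positivity) (by positivity)
      _ = _ := by ring
  rw [← Real.norm_eq_abs]
  calc _ ≤ ∫ x : PhaseSpace N, M * Cm * Real.exp (-c * s) *
        ((1 + x.2 ⟨0, hN⟩ ^ 2 + x.2 ⟨N - 1, by omega⟩ ^ 2) *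
          Real.exp ((-1 / T + ϑ) * (pinnedChain ω₂ lam β γ).hamiltonian N x)) :=
        norm_integral_le_of_norm_le (hIw.const_mul _) (Eventually.of_forall hbd)
    _ = _ := by rw [integral_const_mul, hM]; ring

end OddMomentBound

section LinearResponse

variable {ω₂ lam β γ : ℝ} (hω : 0 < ω₂) (hl : 0 ≤ lam) (hβ : 0 < β) (hγ : 0 < γ)
  (hN : 0 < N) {T : ℝ} (hT : 0 < T) {δ₀ : ℝ} (hδ₀ : 0 < δ₀) (hδ₀T : δ₀ < 2 * T)
  {ϑ : ℝ} (hϑ : 0 < ϑ) (hϑT : ϑ < 1 / (T + δ₀ / 2))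
  {φ : PhaseSpace N → ℝ} (hφ2 : ContDiff ℝ 2 φ) {C : ℝ}
  (hφ : ∀ y, |φ y| ≤ C * Real.exp (ϑ * (pinnedChain ω₂ lam β γ).hamiltonian N y))
include hω hl hβ hγ hN hT hδ₀ hδ₀T hϑ hϑT hφ2 hφ

omit hω hl hβ hγ hN hT hδ₀ hϑ hφ2 hφ in
/-- For `|δ| < δ₀ < 2T`: both bath temperatures `T ± δ/2` are positive and
`ϑ < 1/(T + δ₀/2) ≤ 1/max(T + δ/2, T - δ/2)`. -/
theorem bath_facts_of_abs_lt {δ : ℝ} (hδ : |δ| < δ₀) :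
    0 < T + δ / 2 ∧ 0 < T - δ / 2 ∧ ϑ < 1 / max (T + δ / 2) (T - δ / 2) := by
  have h1 := abs_lt.1 hδ
  have hL : 0 < T + δ / 2 := by linarith
  have hR : 0 < T - δ / 2 := by linarith
  refine ⟨hL, hR, hϑT.trans_le ?_⟩
  refine one_div_le_one_div_of_le (lt_max_of_lt_left hL) (max_le (by linarith) (by linarith))

/-- **Linear response at equilibrium from uniform mixing and kernel continuity.** Let `μ_δ`
(`|δ| < δ₀`) be invariant probability measures of the transition semigroups of the pinned chain with baths
at `T ± δ/2`. Assume `hUM`: the exponential convergence `|P^{(δ)}_t f(z) - μ_δ(f)| ≤ C_m e^{ϑH(z)} e^{-ct}`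
(continuous `|f| ≤ e^{ϑH}`) with constants `C_m, c` independent of `|δ| < δ₀`; and `hCONT`: for all
`s, x`, `δ ↦ P^{(δ)}_s φ(x)` is continuous at `δ = 0`. Then
`δ⁻¹(μ_δ(φ) - μ_0(φ)) → (γ/2T²) Z⁻¹ ∫₀^∞ ∫ P_s φ · e^{-H/T}(p_0² - p_{N-1}²) dx ds` as `δ → 0`, `δ ≠ 0`,
with `P_s` the equilibrium kernels (both baths at `T`) and `Z = ∫ e^{-H/T} dx`. -/
theorem pinnedChain_linear_response_of_uniformMixing {Cm c : ℝ} (hCm : 0 ≤ Cm) (hc : 0 < c)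
    (hUM : ∀ δ : ℝ, |δ| < δ₀ → ∀ μ : Measure (PhaseSpace N), IsProbabilityMeasure μ →
      (∀ t : ℝ≥0, μ.bind ((pinnedChain ω₂ lam β γ).transitionKernel N (T + δ / 2) (T - δ / 2) t) = μ) →
      ∀ (z : PhaseSpace N) (t : ℝ≥0) (f : PhaseSpace N → ℝ), Continuous f →
        (∀ y, |f y| ≤ Real.exp (ϑ * (pinnedChain ω₂ lam β γ).hamiltonian N y)) →
        |(∫ y, f y ∂((pinnedChain ω₂ lam β γ).transitionKernel N (T + δ / 2) (T - δ / 2) t z)) -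
            ∫ y, f y ∂μ| ≤
          Cm * Real.exp (ϑ * (pinnedChain ω₂ lam β γ).hamiltonian N z) * Real.exp (-c * t))
    (hCONT : ∀ (s : ℝ≥0) (x : PhaseSpace N),
      Tendsto (fun δ : ℝ => ∫ y, φ y ∂((pinnedChain ω₂ lam β γ).transitionKernel N (T + δ / 2)
        (T - δ / 2) s x)) (𝓝 0) (𝓝 (∫ y, φ y ∂((pinnedChain ω₂ lam β γ).transitionKernel N T T s x))))
    (μf : ℝ → Measure (PhaseSpace N)) (hμP : ∀ δ, |δ| < δ₀ → IsProbabilityMeasure (μf δ))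
    (hμI : ∀ δ, |δ| < δ₀ → ∀ t : ℝ≥0,
      (μf δ).bind ((pinnedChain ω₂ lam β γ).transitionKernel N (T + δ / 2) (T - δ / 2) t) = μf δ) :
    Tendsto (fun δ : ℝ => ((∫ y, φ y ∂(μf δ)) - ∫ y, φ y ∂(μf 0)) / δ) (𝓝[≠] 0)
      (𝓝 ((γ / (2 * T ^ 2)) / (∫ x, Real.exp (-1 / T * (pinnedChain ω₂ lam β γ).hamiltonian N x)) *
        ∫ s in Ioi (0 : ℝ), ∫ x, (∫ y, φ y ∂((pinnedChain ω₂ lam β γ).transitionKernel N T T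
            s.toNNReal x)) *
          (Real.exp (-1 / T * (pinnedChain ω₂ lam β γ).hamiltonian N x) *
            (x.2 ⟨0, hN⟩ ^ 2 - x.2 ⟨N - 1, by omega⟩ ^ 2)))) := by
  haveI := isAddHaarMeasure_volume_phaseSpace N
  have hHc : Continuous ((pinnedChain ω₂ lam β γ).hamiltonian N) :=
    (pinnedChain_contDiff_hamiltonian ω₂ lam β γ N (n := 0)).continuous
  have hC : 0 ≤ C := by
    have := (abs_nonneg _).trans (hφ 0)
    exact nonneg_of_mul_nonneg_left this (Real.exp_pos _)
  have hϑT' : -1 / T + ϑ < 0 := by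
    obtain ⟨-, -, h⟩ := bath_facts_of_abs_lt hδ₀T hϑT (δ := 0) (by simpa using hδ₀)
    exact neg_inv_add_lt_zero hT h
  -- the partition function
  set Z : ℝ := ∫ x, Real.exp (-1 / T * (pinnedChain ω₂ lam β γ).hamiltonian N x) with hZ
  have hIθ := integrable_exp_mul_hamiltonian hω hl hβ.le γ (N := N) (c := -1 / T)
    (by rw [neg_div]; exact neg_neg_of_pos (one_div_pos.2 hT))
  have hZ0 : 0 < Z := integral_exp_pos hIθ
  -- notation for the odd-moment pairing and its time integral
  set Ψ : ℝ → ℝ → ℝ := fun δ s => ∫ x, (∫ y, φ y ∂((pinnedChain ω₂ lam β γ).transitionKernel N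
      (T + δ / 2) (T - δ / 2) s.toNNReal x)) *
    (Real.exp (-1 / T * (pinnedChain ω₂ lam β γ).hamiltonian N x) *
      (x.2 ⟨0, hN⟩ ^ 2 - x.2 ⟨N - 1, by omega⟩ ^ 2)) with hΨ
  set I : ℝ → ℝ := fun δ => ∫ s in Ioi (0 : ℝ), Ψ δ s with hI
  -- the exact identity at every `|δ| < δ₀`
  have hid : ∀ δ : ℝ, |δ| < δ₀ → Z * (∫ y, φ y ∂(μf δ)) -
      ∫ x, Real.exp (-1 / T * (pinnedChain ω₂ lam β γ).hamiltonian N x) * φ x =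
      δ * (γ / (2 * T ^ 2)) * I δ := by
    intro δ hδ
    obtain ⟨hTL, hTR, hϑ'⟩ := bath_facts_of_abs_lt hδ₀T hϑT hδ
    haveI := hμP δ hδ
    exact pinnedChain_exact_response_identity hω hl hβ hγ hN hT hTL hTR hϑ hϑ' hφ2 hφ (μf δ)
      (fun t => hμI δ hδ t)
  -- hence the difference quotient is `(γ/2T²) Z⁻¹ I(δ)` for `0 < |δ| < δ₀`
  have hquot : ∀ᶠ δ in 𝓝[≠] (0 : ℝ), (γ / (2 * T ^ 2)) / Z * I δ =
      ((∫ y, φ y ∂(μf δ)) - ∫ y, φ y ∂(μf 0)) / δ := by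
    have hball : ∀ᶠ δ in 𝓝 (0 : ℝ), |δ| < δ₀ := by
      have : Metric.ball (0 : ℝ) δ₀ ∈ 𝓝 (0 : ℝ) := Metric.ball_mem_nhds 0 hδ₀
      filter_upwards [this] with δ hδ
      simpa [Real.dist_eq] using hδ
    have h0 := hid 0 (by simpa using hδ₀)
    rw [zero_mul, zero_mul, sub_eq_zero] at h0
    set A : ℝ := ∫ x, Real.exp (-1 / T * (pinnedChain ω₂ lam β γ).hamiltonian N x) * φ x with hA
    filter_upwards [hball.filter_mono nhdsWithin_le_nhds, self_mem_nhdsWithin] with δ hδ hδ0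
    rw [Set.mem_compl_iff, Set.mem_singleton_iff] at hδ0
    have h := hid δ hδ
    have hμ0 : ∫ y, φ y ∂(μf 0) = A / Z := by
      rw [eq_div_iff hZ0.ne', mul_comm]; exact h0
    have hμδ : ∫ y, φ y ∂(μf δ) = (A + δ * (γ / (2 * T ^ 2)) * I δ) / Z := by
      rw [eq_div_iff hZ0.ne']; linarith
    rw [hμ0, hμδ, div_sub_div_same, add_sub_cancel_left]
    field_simp
  -- continuity of `I` at `δ = 0` (dominated convergence in `s`, then in `x`), via sequences
  have hIlim : Tendsto I (𝓝 0) (𝓝 (∫ s in Ioi (0 : ℝ), ∫ x,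
      (∫ y, φ y ∂((pinnedChain ω₂ lam β γ).transitionKernel N T T s.toNNReal x)) *
        (Real.exp (-1 / T * (pinnedChain ω₂ lam β γ).hamiltonian N x) *
          (x.2 ⟨0, hN⟩ ^ 2 - x.2 ⟨N - 1, by omega⟩ ^ 2)))) := by
    refine tendsto_of_seq_tendsto fun δn hδn => ?_
    have hev : ∀ᶠ n in atTop, |δn n| < δ₀ := by
      have : Metric.ball (0 : ℝ) δ₀ ∈ 𝓝 (0 : ℝ) := Metric.ball_mem_nhds 0 hδ₀
      filter_upwards [hδn this] with n hn
      simpa [Real.dist_eq] using hn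
    have hIw := integrable_momentSq_mul_exp_mul_hamiltonian hω hl hβ.le γ hN hϑT'
    set B' : ℝ := max C 1 * Cm * ∫ x : PhaseSpace N, (1 + x.2 ⟨0, hN⟩ ^ 2 + x.2 ⟨N - 1, by omega⟩ ^ 2) *
      Real.exp ((-1 / T + ϑ) * (pinnedChain ω₂ lam β γ).hamiltonian N x) with hB'
    have hδ' : ∃ δ' : ℝ, δ' ≠ 0 ∧ 0 < T + δ' / 2 ∧ 0 < T - δ' / 2 ∧
        ϑ < 1 / max (T + δ' / 2) (T - δ' / 2) :=
      ⟨δ₀ / 2, by positivity, (bath_facts_of_abs_lt hδ₀T hϑT (δ := δ₀ / 2)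
        (by rw [abs_of_pos (by positivity)]; linarith))⟩
    refine tendsto_integral_filter_of_dominated_convergence (fun s => B' * Real.exp (-c * s))
      (Eventually.of_forall fun n =>
        (measurable_oddMoment_pairing hω hl hβ.le hγ hN hφ2).aestronglyMeasurable)
      ?_ ((exp_neg_integrableOn_Ioi 0 hc).const_mul B') ?_
    · filter_upwards [hev] with n hn
      obtain ⟨hTL, hTR, hϑ'⟩ := bath_facts_of_abs_lt hδ₀T hϑT hn
      haveI := hμP (δn n) hn
      rw [ae_restrict_iff' measurableSet_Ioi]
      refine Eventually.of_forall fun s hs => ?_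
      rw [Real.norm_eq_abs]
      exact abs_oddMoment_pairing_le_of_mixing hω hl hβ.le hγ hN hT hTL hTR hϑ hϑ' hφ2 hφ hδ' (μf (δn n))
        hCm (hUM (δn n) hn (μf (δn n)) inferInstance (hμI (δn n) hn)) hs
    · rw [ae_restrict_iff' measurableSet_Ioi]
      refine Eventually.of_forall fun s hs => ?_
      -- dominated convergence in `x`
      have hs0 : 0 ≤ s := le_of_lt hs
      refine tendsto_integral_filter_of_dominated_convergence
        (fun x => C * Real.exp (ϑ * γ * (2 * T) * s) *
          ((1 + x.2 ⟨0, hN⟩ ^ 2 + x.2 ⟨N - 1, by omega⟩ ^ 2) *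
            Real.exp ((-1 / T + ϑ) * (pinnedChain ω₂ lam β γ).hamiltonian N x)))
        (Eventually.of_forall fun n => ?_) ?_ (hIw.const_mul _) (Eventually.of_forall fun x => ?_)
      · exact ((pinnedChain_measurable_integral_kernel N _ _ hφ2.continuous.stronglyMeasurable _).mul
          ((Real.continuous_exp.comp (continuous_const.mul hHc)).mul
            ((((continuous_apply _).comp continuous_snd).pow 2).sub
              (((continuous_apply _).comp continuous_snd).pow 2))).measurable).aestronglyMeasurable
      · filter_upwards [hev] with n hn
        obtain ⟨hTL, hTR, hϑ'⟩ := bath_facts_of_abs_lt hδ₀T hϑT hn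
        refine Eventually.of_forall fun x => ?_
        have hb := pinnedChain_abs_integral_kernel_le' hω hl hβ.le hγ hN hTL hTR hϑ hϑ' hφ s.toNNReal x
        rw [Real.coe_toNNReal _ hs0, show T + δn n / 2 + (T - δn n / 2) = 2 * T by ring] at hb
        have hp : |x.2 ⟨0, hN⟩ ^ 2 - x.2 ⟨N - 1, by omega⟩ ^ 2| ≤
            1 + x.2 ⟨0, hN⟩ ^ 2 + x.2 ⟨N - 1, by omega⟩ ^ 2 := by
          have h1 : 0 ≤ x.2 ⟨0, hN⟩ ^ 2 := sq_nonneg _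
          have h2 : 0 ≤ x.2 ⟨N - 1, by omega⟩ ^ 2 := sq_nonneg _
          rw [abs_le]; constructor <;> linarith
        rw [Real.norm_eq_abs, abs_mul, abs_mul, abs_of_pos (Real.exp_pos _),
          show (-1 / T + ϑ) * (pinnedChain ω₂ lam β γ).hamiltonian N x =
            -1 / T * (pinnedChain ω₂ lam β γ).hamiltonian N x +
              ϑ * (pinnedChain ω₂ lam β γ).hamiltonian N x by ring, Real.exp_add]
        have hE1 := (Real.exp_pos (-1 / T * (pinnedChain ω₂ lam β γ).hamiltonian N x)).le
        calc _ ≤ (C * (Real.exp (ϑ * γ * (2 * T) * s) *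
              Real.exp (ϑ * (pinnedChain ω₂ lam β γ).hamiltonian N x))) *
            (Real.exp (-1 / T * (pinnedChain ω₂ lam β γ).hamiltonian N x) *
              (1 + x.2 ⟨0, hN⟩ ^ 2 + x.2 ⟨N - 1, by omega⟩ ^ 2)) :=
            mul_le_mul hb (mul_le_mul_of_nonneg_left hp hE1) (by positivity) (by positivity)
          _ = _ := by ring
      · have h := (hCONT s.toNNReal x).comp hδn
        exact h.mul_const _
  -- assemble
  have hmain := (hIlim.const_mul ((γ / (2 * T ^ 2)) / Z)).mono_left
    (nhdsWithin_le_nhds (s := ({(0 : ℝ)} : Set ℝ)ᶜ))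
  exact hmain.congr' hquot

end LinearResponse

end Summit.AtomisticToContinuum.FouriersLaw.Theorems

end
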